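import Literature.Computability.QuantumComplexity.SignedForrelationMemCorrect
import Literature.Computability.QuantumComplexity.SignedCubicForrelation
import Literature.Computability.Complexity.PostBPPHashLanguage
import HarnessLib

/-!
# Signed 2-fold Forrelation is in `PromiseBQP`, III: the amplitude on the promise and membership

Last file of the white-box version of Aaronson–Ambainis, §3.2 Prop. 6 at `k = 2`
(`SignedForrelationGadget.lean`, `SignedForrelationMemSpec.lean`, `SignedForrelationMemCorrect.lean`).
For an instance `I = (n, 2, C₀, C₁)` with code `x`:

* the bent bit of the machine (`qM`, the `𝔽₂` inner product of the two halves of an even number of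
  data wires) is the self-dual bent function `ipHalf` of the gadget file (`qM_ofFn_append`,
  `isSelfDualBent_qM`; the `AND`-count of `PostBPPHashLanguage.lean`);
* **inside the promise** (`|Φ(I)| ≥ 3/5`) at most one wire is idle (`n ≤ #R + 1`, since two idle
  wires already force `|Φ| ≤ 1/2`: `ForrMem.value_eq`), so `W_d = n + [n odd]` is even and `≥ n`, the
  return amplitude is the gadget amplitude `(-1)^{C₁(0)} (1 + Φ_W)/2` with
  `Φ_W = Φ(I) · ρ`, `ρ ∈ {1, 1/√2}` (`ρ = 1/√2` exactly when `n` is odd: one idle data wire;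
  `forrelation_cfun`, `ForrMem.kForrelationValue_ext`), of modulus `(1 + Φ(I) ρ)/2`;
* hence yes-instances (`Φ ≥ 3/5`: modulus `≥ 71/100`) are accepted with probability `≥ 2/3` and
  no-instances (`Φ ≤ -3/5`: modulus `≤ 29/100`) with probability `≤ 1/3` (`accept_yes`, `accept_no`);
* **`signedForrelationProblem_mem_PromiseBQP`** (Aaronson–Ambainis 2018, §3.2 Prop. 6 with §6, p. 26:
  the SIGNED explicit 2-fold Forrelation problem "`Φ ≥ 3/5` vs `Φ ≤ -3/5`" is in `PromiseBQP`), and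
  its cubic sub-promise `signedCubicForrelationProblem_two_mem_PromiseBQP`
  (`SignedCubicForrelation.lean`; route `QuantumAdvantage/CubicForrelation`).

## References

* S. Aaronson, A. Ambainis, *Forrelation: a problem that optimally separates quantum from classical
  computing*, SIAM J. Comput. 47 (2018), §3.2 Prop. 6 (arXiv:1411.5729 pp. 11–12), §6 (p. 26)
  [AaronsonAmbainis2018].
* J. Watrous, *Quantum computational complexity*, in: Encyclopedia of Complexity and Systems
  Science, Springer 2009, §III.2 (`PromiseBQP`, restriction of the promise) [Watrous2009].
-/

noncomputable section

namespace Literature.Computability.QuantumComplexity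

open _root_.Computability Complexity Cryptography PhaseQuery Finset

namespace SgnForrMem

open ForrMem

/-! ### The bent bit of the machine is the inner product of the two halves -/

/-- The `AND`-count of two tuples is the number of common `1`s (through the landed row-parity count
`PostBPPHash.count_zipWith_and`). [folklore] -/
theorem count_zipWith_ofFn {t : ℕ} (u v : Fin t → Bool) :
    ((List.ofFn u).zipWith (· && ·) (List.ofFn v)).count true = (univ.filter fun i : Fin t => u i && v i).card := by
  rw [PostBPPHash.count_zipWith_and, List.length_ofFn, Nat.count_eq_card_filter_range, ← Finset.card_map Fin.valEmbedding]
  congr 1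
  ext c
  simp only [Finset.mem_filter, Finset.mem_range, Finset.mem_map, Finset.mem_univ, true_and, Fin.valEmbedding_apply]
  constructor
  · rintro ⟨hc, h⟩
    refine ⟨⟨c, hc⟩, ?_, rfl⟩
    simpa [List.getD_eq_getElem?_getD, List.getElem?_ofFn, hc] using h
  · rintro ⟨i, h, rfl⟩
    refine ⟨i.isLt, ?_⟩
    simpa [List.getD_eq_getElem?_getD, List.getElem?_ofFn] using h

/-- **The bent bit of the machine on `u ++ v` is `⟨u, v⟩`** (`ipHalf` of the gadget file). [folklore] -/
theorem qM_ofFn_append {t : ℕ} (u v : Fin t → Bool) : qM t (List.ofFn (Fin.append u v)) = ipHalf t (Fin.append u v) := by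
  rw [List.ofFn_fin_append, qM, List.take_left' (by simp), List.drop_left' (by simp), List.take_of_length_le (by simp),
    count_zipWith_ofFn, ipHalf]
  simp only [Fin.append_left, Fin.append_right]

/-- On an even number `m` of wires the bent bit of the machine is self-dual bent and vanishes at `0`.
[cite: ODonnell2014, §1.4] -/
theorem isSelfDualBent_qM {m : ℕ} (hm : Even m) :
    IsSelfDualBent (fun w : Fin m → Bool => qM (m / 2) (List.ofFn w)) ∧ qM (m / 2) (List.ofFn fun _ : Fin m => false) = false := by
  obtain ⟨t, rfl⟩ := hm
  have ht : (t + t) / 2 = t := by omega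
  have e : (fun w : Fin (t + t) → Bool => qM ((t + t) / 2) (List.ofFn w)) = ipHalf t := by
    funext w
    obtain ⟨⟨u, v⟩, rfl⟩ := (Fin.appendEquiv t t).surjective w
    rw [ht]
    exact qM_ofFn_append u v
  refine ⟨e ▸ isSelfDualBent_ipHalf t, ?_⟩
  have := congrFun e (fun _ => false)
  rw [this, ipHalf_zero]

/-! ### The amplitude inside the promise -/

variable (I : KForrelationInstance)

/-- **Two idle wires halve `Φ`**: if `n ≥ #R + 2` then `|Φ(I)| ≤ 1/2` (for `k = 2` each idle wire
costs a factor `1/√2`). [cite: AaronsonAmbainis2018, §3.2 and §6] -/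
theorem abs_value_le_half (hk : I.k = 2) (h : sR I + 2 ≤ I.n) : |I.value| ≤ 1 / 2 := by
  rw [value_eq, hk, idleFactor_of_even (by norm_num), abs_mul, abs_pow, abs_of_nonneg (inv_nonneg.2 (Real.sqrt_nonneg 2))]
  obtain ⟨d, hd⟩ : ∃ d, I.n - sR I = d + 2 := ⟨I.n - sR I - 2, by omega⟩
  have hsq : ((Real.sqrt 2)⁻¹) ^ 2 = 1 / 2 := by rw [inv_pow, Real.sq_sqrt (by norm_num : (0 : ℝ) ≤ 2)]; norm_num
  rw [hd, pow_add, hsq]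
  have h1 : |phi0 I| ≤ 1 := abs_kForrelationValue_le_one _
  have h2 : (Real.sqrt 2)⁻¹ ^ d ≤ 1 :=
    pow_le_one₀ (inv_nonneg.2 (Real.sqrt_nonneg 2)) (inv_le_one_of_one_le₀ (Real.one_le_sqrt.2 (by norm_num)))
  have h3 : 0 ≤ (Real.sqrt 2)⁻¹ ^ d := by positivity
  nlinarith [abs_nonneg (phi0 I)]

/-- Inside the promise at most one wire is idle. [cite: AaronsonAmbainis2018, §6 (p. 26)] -/
theorem n_le_of_promise (hk : I.k = 2) (hv : (3 : ℝ) / 5 ≤ |I.value|) : I.n ≤ sR I + 1 := by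
  by_contra h
  have := abs_value_le_half I hk (by omega)
  linarith

/-- Inside the promise `W_d = n + [n odd]`. [folklore] -/
theorem WdS_eq_of_le (h : I.n ≤ sR I + 1) : WdS I = I.n + if Even I.n then 0 else 1 := by
  unfold WdS; rw [min_eq_left h]

/-- Inside the promise `W_d` is even. [folklore] -/
theorem even_WdS_of_le (h : I.n ≤ sR I + 1) : Even (WdS I) := by
  rw [WdS_eq_of_le I h]
  split_ifs with he
  · simpa using he
  · rw [Nat.even_add_one]; exact he

/-- **The forrelation of the two circuits read through the rank layout on `m ≥ #R` wires** is
`Φ₀ · ρ₂^{m - #R}`. [cite: AaronsonAmbainis2018, §3.2] -/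
theorem forrelation_cfun (hk : I.k = 2) (m : ℕ) (hm : sR I ≤ m) :
    forrelation (fun w : Fin m → Bool => cfun I 0 w) (fun w => cfun I 1 w) = phi0 I * idleFactor 2 ^ (m - sR I) := by
  rw [show idleFactor 2 = idleFactor I.k by rw [hk], ← kForrelationValue_ext I m hm]
  obtain ⟨n, k, C⟩ := I
  cases hk
  rw [kForrelationValue_fin_two]
  simp [cfun]

/-- **Inside the promise `Φ_W = Φ(I) · ρ` with `7/10 ≤ ρ ≤ 1`** (`ρ = 1` for even `n`, `1/√2` for odd `n`).
[cite: AaronsonAmbainis2018, §3.2 and §6] -/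
theorem forrelation_cfun_WdS (hk : I.k = 2) (h : I.n ≤ sR I + 1) :
    ∃ ρ : ℝ, (7 / 10 ≤ ρ ∧ ρ ≤ 1) ∧
      forrelation (fun w : Fin (WdS I) → Bool => cfun I 0 w) (fun w => cfun I 1 w) = I.value * ρ := by
  have hs := length_Rl_le I
  rw [forrelation_cfun I hk (WdS I) (sR_le_WdS I), value_eq, hk, WdS_eq_of_le I h, idleFactor_of_even (by norm_num)]
  have hr : (7 : ℝ) / 10 ≤ (Real.sqrt 2)⁻¹ := by
    rw [le_inv_comm₀ (by norm_num) (Real.sqrt_pos.2 (by norm_num)), Real.sqrt_le_left (by norm_num)]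
    norm_num
  have hr1 : (Real.sqrt 2)⁻¹ ≤ 1 := inv_le_one_of_one_le₀ (Real.one_le_sqrt.2 (by norm_num))
  split_ifs with he
  · exact ⟨1, ⟨by norm_num, le_rfl⟩, by rw [Nat.add_zero, mul_one]⟩
  · refine ⟨(Real.sqrt 2)⁻¹, ⟨hr, hr1⟩, ?_⟩
    rw [show I.n + 1 - (Rl I).length = (I.n - (Rl I).length) + 1 by omega, pow_succ, mul_assoc]

/-- **The return amplitude inside the promise** has modulus `(1 + Φ(I) ρ)/2` for some `ρ ∈ [7/10, 1]`.
[cite: AaronsonAmbainis2018, §3.2 Prop. 6] -/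
theorem norm_phiFin_of_promise (hk : I.k = 2) (hv : (3 : ℝ) / 5 ≤ |I.value|) (A : Language Bool) :
    ∃ ρ : ℝ, (7 / 10 ≤ ρ ∧ ρ ≤ 1) ∧ ‖phiFin paramsS specS I.encode A fun _ => false‖ = (1 + I.value * ρ) / 2 := by
  have h := n_le_of_promise I hk hv
  obtain ⟨hq, hq0⟩ := isSelfDualBent_qM (even_WdS_of_le I h)
  obtain ⟨ρ, hρ, e⟩ := forrelation_cfun_WdS I hk h
  refine ⟨ρ, hρ, ?_⟩
  rw [phiFin_encode I hk, gS_vec, Complex.norm_real, Real.norm_eq_abs]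
  have hg := kForrelationValue_gadget (fun w : Fin (WdS I) → Bool => cfun I 0 w) (fun w => cfun I 1 w) (qW I) hq hq0
  simp only at hg
  rw [show (qW I) = fun w => qW I w from rfl] at hg
  erw [hg, abs_gadget, e]

/-! ### Acceptance probabilities and membership -/

/-- `|Φ(I)| ≤ 1`. [cite: AaronsonAmbainis2018, §1.1.3 (p. 5)] -/
theorem abs_value_le_one : |I.value| ≤ 1 := abs_kForrelationValue_le_one _

/-- The threshold arithmetic, yes side: modulus `≥ 71/100` gives acceptance `≥ 2/3`. [cite: AaronsonAmbainis2018, §6 (p. 26)] -/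
theorem accept_ge {a : ℝ} (ha : (71 : ℝ) / 100 ≤ a) (ha1 : a ≤ 1) : (2 : ℝ) / 3 ≤ 1 - (1 - a ^ 2) ^ 3 := by
  have h0 : 0 ≤ 1 - a ^ 2 := by nlinarith
  have h1 : 1 - a ^ 2 ≤ 4959 / 10000 := by nlinarith
  have h2 : (1 - a ^ 2) ^ 3 ≤ (4959 / 10000 : ℝ) ^ 3 := pow_le_pow_left₀ h0 h1 3
  norm_num at h2
  linarith

/-- The threshold arithmetic, no side: modulus `≤ 29/100` gives acceptance `≤ 1/3`. [cite: AaronsonAmbainis2018, §6 (p. 26)] -/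
theorem accept_le {a : ℝ} (ha : a ≤ (29 : ℝ) / 100) (ha0 : 0 ≤ a) : 1 - (1 - a ^ 2) ^ 3 ≤ (1 : ℝ) / 3 := by
  have h1 : (9159 / 10000 : ℝ) ≤ 1 - a ^ 2 := by nlinarith
  have h2 : (9159 / 10000 : ℝ) ^ 3 ≤ (1 - a ^ 2) ^ 3 := pow_le_pow_left₀ (by norm_num) h1 3
  norm_num at h2
  linarith

/-- **Yes-instances (`Φ ≥ 3/5`) are accepted with probability `≥ 2/3`.** [cite: AaronsonAmbainis2018, §3.2 Prop. 6] -/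
theorem accept_yes (hk : I.k = 2) (hv : (3 : ℝ) / 5 ≤ I.value) (A : Language Bool) :
    (2 : ℝ) / 3 ≤ 1 - (1 - ‖phiFin paramsS specS I.encode A fun _ => false‖ ^ 2) ^ 3 := by
  obtain ⟨ρ, ⟨hρ, hρ1⟩, e⟩ := norm_phiFin_of_promise I hk (hv.trans (le_abs_self _)) A
  have h1 := (abs_le.1 (abs_value_le_one I)).2
  rw [e]
  exact accept_ge (by nlinarith) (by nlinarith)

/-- **No-instances (`Φ ≤ -3/5`) are accepted with probability `≤ 1/3`.** [cite: AaronsonAmbainis2018, §3.2 Prop. 6] -/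
theorem accept_no (hk : I.k = 2) (hv : I.value ≤ -((3 : ℝ) / 5)) (A : Language Bool) :
    1 - (1 - ‖phiFin paramsS specS I.encode A fun _ => false‖ ^ 2) ^ 3 ≤ (1 : ℝ) / 3 := by
  have hv' : (3 : ℝ) / 5 ≤ |I.value| := by rw [abs_of_neg (by linarith)]; linarith
  obtain ⟨ρ, ⟨hρ, hρ1⟩, e⟩ := norm_phiFin_of_promise I hk hv' A
  have h1 := (abs_le.1 (abs_value_le_one I)).1
  rw [e]
  exact accept_le (by nlinarith) (by nlinarith)

/-- **Aaronson–Ambainis 2018, §3.2 Prop. 6 (white box, `k = 2`): SIGNED explicit 2-fold Forrelation —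
yes `Φ ≥ 3/5`, no `Φ ≤ -3/5` — is in `PromiseBQP`**, decided by the uniform Clifford+T phase-query
family `PhaseQuery.family SgnForrMem.paramsS` (one control wire, three phase layers, full Hadamard
layers; acceptance `1 − (1 − M²)³` with `M = (1 + Φρ)/2`). [cite: AaronsonAmbainis2018, §3.2 Prop. 6 and §6 (p. 26)] -/
theorem _root_.Literature.Computability.QuantumComplexity.signedForrelationProblem_mem_PromiseBQP :
    signedForrelationProblem ∈ PromiseBQP := by
  refine mem_PromiseBQP_of_spec paramsS specS signedForrelationProblem (fun x hx => ?_) (fun x hx => ?_)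
  · obtain ⟨I, ⟨hI, hk⟩, rfl⟩ := hx
    exact accept_yes I hk hI.2 0
  · obtain ⟨I, ⟨hI, hk⟩, rfl⟩ := hx
    exact accept_no I hk hI.2 0

/-- **The signed CUBIC 2-fold Forrelation problem is in `PromiseBQP`** (sub-promise of the signed
problem: `n` even, degree `≤ 3`; the support item `SignedCubicForrelationMemPromiseBQP` of route
`QuantumAdvantage/CubicForrelation`). [cite: AaronsonAmbainis2018, §3.2 Prop. 6 and §6 Thm 25–26] -/
theorem _root_.Literature.Computability.QuantumComplexity.signedCubicForrelationProblem_two_mem_PromiseBQP :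
    signedCubicForrelationProblem 2 ∈ PromiseBQP :=
  mem_PromiseBQP_of_subset (Q := signedForrelationProblem)
    (Set.image_mono fun _ hI => ⟨hI.1, hI.2.1⟩) (Set.image_mono fun _ hI => ⟨hI.1, hI.2.1⟩)
    signedForrelationProblem_mem_PromiseBQP

end SgnForrMem

end Literature.Computability.QuantumComplexity
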